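import Summits.ValiantsHypothesis.ValiantsHypothesis.Theorems.KPlusLogSqLawTridiagonalRealStaticRootGap

/-!
# Route «KPlusLogSqLaw», crux `WeakLifting` (stmt-ValiantsHypothesis-19561) — REAL side of the tridiagonal sector:
# the ROOT-GAP COUNT — the number of positive determinant zeros of a static symmetric tridiagonal design is at most one plus twice the number of
# positive zeros of (previous continuant) × (gauged Wronskian)

HONEST FRAMING.  Helper (`--supports stmt-ValiantsHypothesis-19561 --as helper`), seat val-sym-lift-p2 (g15), cell `pub-symmetroid`, 2026-08-28; α register, UPPER /
structure side; all sizes.  The counting form of this seat's ROOT-GAP LAW (`…TridiagonalRealStaticRootGap`, p636675): a REDUCTION of the register's row `B m` to the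
positive zeros of `D_{m−1}` and of the gauged Wronskian `Ω_G = X·Wr(D_m, D_{m−1}) − G_{m−1}·D_{m−1}D_m` (the signed sum of squares `Σ_j a_j(d_j − G_j)X^{d_j}Π_jD_j²`
of p633021/p634007), NOT a bound by itself.
* `card_le_two_mul_card_add_one_of_gaps` — finite combinatorics on `ℝ`: if every pair of CONSECUTIVE elements `a < a'` of a finite set `A` encloses (`a ≤ b ≤ a'`)
  an element `b` of a finite set `B`, then `#A ≤ 2·#B + 1` (an element of `B` serves at most the two gaps it is an endpoint of).
* **`card_posRoots_le_of_gaugedWronskian` (all sizes, every gauge):** for a static symmetric tridiagonal design and ANY finite set `B` containing every positive zero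
  of `D_k` and every positive zero of `Ω_G`:  `#{positive zeros of D_{k+1}} ≤ 2·#B + 1`.  (If `D_k·Ω_G` is a non-zero polynomial, `B` = its positive root set.)
READING (seat memo ROOT-TYPE-CALCULUS §3b/§6): the α law «B m ≤ 2m − 3» would follow from a linear budget for the positive zeros of the `(m+1)`-term signed sums of
squares `Ω_G` (best gauge) — located: on the register's breathing extremal designs `Ω_G` changes sign exactly `Z − 1` times and `D_{m−1}` at most twice.
Nothing here bears on `WeakLifting` / `TropicalB` (stmt-19771) in their windows, on Conjecture B, on the Door-A registers, on `MatrixDescartes` (stmt-18050) or on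
VP ≠ VNP.  [folklore: Rolle-type gap counting; bookkeeping of this seat]
-/

set_option linter.dupNamespace false
set_option autoImplicit false

namespace Summit.ValiantsHypothesis.ValiantsHypothesis.Theorems.KPlusLogSqLaw

namespace StaticTridiagonalRealPotential

open Polynomial Finset

/-! ## 1. Gap counting on the line -/

/-- **Gap counting.**  If between (inclusively) any two CONSECUTIVE elements of the finite set `A ⊂ ℝ` there is an element of the finite set `B`, then
`#A ≤ 2·#B + 1`. [folklore] -/
theorem card_le_two_mul_card_add_one_of_gaps : ∀ (n : ℕ) (A B : Finset ℝ), A.card = n →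
    (∀ a ∈ A, ∀ a' ∈ A, a < a' → (∀ z ∈ A, ¬ (a < z ∧ z < a')) → ∃ b ∈ B, a ≤ b ∧ b ≤ a') →
    A.card ≤ 2 * B.card + 1 := by
  intro n
  induction n using Nat.strong_induction_on with
  | _ n ih =>
    intro A B hn hgap
    by_cases hA : A.card ≤ 1
    · omega
    · -- the two smallest elements
      have hne : A.Nonempty := Finset.card_pos.mp (by omega)
      set a₀ := A.min' hne with ha₀
      have ha₀mem : a₀ ∈ A := Finset.min'_mem A hne
      set A₁ := A.erase a₀ with hA₁
      have hA₁card : A₁.card = A.card - 1 := Finset.card_erase_of_mem ha₀mem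
      have hne₁ : A₁.Nonempty := Finset.card_pos.mp (by omega)
      set a₁ := A₁.min' hne₁ with ha₁
      have ha₁mem₁ : a₁ ∈ A₁ := Finset.min'_mem A₁ hne₁
      have ha₁mem : a₁ ∈ A := Finset.mem_of_mem_erase ha₁mem₁
      have ha₁ne : a₁ ≠ a₀ := Finset.ne_of_mem_erase ha₁mem₁
      have hlt : a₀ < a₁ := lt_of_le_of_ne (Finset.min'_le A a₁ ha₁mem) ha₁ne.symm
      -- every element of `A` other than `a₀` is `≥ a₁`
      have hge : ∀ z ∈ A, z ≠ a₀ → a₁ ≤ z := fun z hz hz0 => Finset.min'_le A₁ z (Finset.mem_erase.mpr ⟨hz0, hz⟩)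
      -- `a₀ < a₁` are consecutive
      have hcons : ∀ z ∈ A, ¬ (a₀ < z ∧ z < a₁) := by
        intro z hz ⟨h1, h2⟩
        exact absurd (hge z hz (ne_of_gt h1)) (not_le.mpr h2)
      obtain ⟨b₀, hb₀, hb₀l, hb₀r⟩ := hgap a₀ ha₀mem a₁ ha₁mem hlt hcons
      rcases lt_or_eq_of_le hb₀r with hb₀lt | hb₀eq
      · -- `b₀ < a₁`: drop `a₀` from `A` and everything `< a₁` from `B`
        set B' := B.filter (fun b => a₁ ≤ b) with hB'
        have hB'card : B'.card + 1 ≤ B.card := by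
          have hsub : B' ⊆ B.erase b₀ := by
            intro b hb
            rw [hB', Finset.mem_filter] at hb
            exact Finset.mem_erase.mpr ⟨fun h => by rw [h] at hb; exact absurd hb.2 (not_le.mpr hb₀lt), hb.1⟩
          have := Finset.card_le_card hsub
          rw [Finset.card_erase_of_mem hb₀] at this
          have hpos : 0 < B.card := Finset.card_pos.mpr ⟨b₀, hb₀⟩
          omega
        have hgap' : ∀ a ∈ A₁, ∀ a' ∈ A₁, a < a' → (∀ z ∈ A₁, ¬ (a < z ∧ z < a')) → ∃ b ∈ B', a ≤ b ∧ b ≤ a' := by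
          intro a ha a' ha' haa' hz
          have haA : a ∈ A := Finset.mem_of_mem_erase ha
          have ha'A : a' ∈ A := Finset.mem_of_mem_erase ha'
          have hane : a ≠ a₀ := Finset.ne_of_mem_erase ha
          have hz' : ∀ z ∈ A, ¬ (a < z ∧ z < a') := by
            intro z hz1 hzz
            by_cases hz0 : z = a₀
            · rw [hz0] at hzz
              exact absurd (lt_of_le_of_lt (Finset.min'_le A a haA) hzz.1) (lt_irrefl _)
            · exact hz z (Finset.mem_erase.mpr ⟨hz0, hz1⟩) hzz
          obtain ⟨b, hb, hbl, hbr⟩ := hgap a haA a' ha'A haa' hz'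
          refine ⟨b, ?_, hbl, hbr⟩
          rw [hB', Finset.mem_filter]
          exact ⟨hb, (hge a haA hane).trans hbl⟩
        have h := ih (A.card - 1) (by omega) A₁ B' hA₁card hgap'
        omega
      · -- `b₀ = a₁`: drop `a₀, a₁` from `A` and everything `≤ a₁` from `B`
        set A₂ := A₁.erase a₁ with hA₂
        have hA₂card : A₂.card = A.card - 2 := by
          rw [hA₂, Finset.card_erase_of_mem ha₁mem₁, hA₁card]; omega
        set B' := B.filter (fun b => a₁ < b) with hB'
        have hB'card : B'.card + 1 ≤ B.card := by
          have hsub : B' ⊆ B.erase b₀ := by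
            intro b hb
            rw [hB', Finset.mem_filter] at hb
            exact Finset.mem_erase.mpr ⟨fun h => by rw [h, hb₀eq] at hb; exact absurd hb.2 (lt_irrefl _), hb.1⟩
          have := Finset.card_le_card hsub
          rw [Finset.card_erase_of_mem hb₀] at this
          have hpos : 0 < B.card := Finset.card_pos.mpr ⟨b₀, hb₀⟩
          omega
        -- every element of `A₂` is `> a₁`
        have hgt : ∀ z ∈ A₂, a₁ < z := by
          intro z hz
          have hz1 : z ∈ A₁ := Finset.mem_of_mem_erase hz
          have hzne : z ≠ a₁ := Finset.ne_of_mem_erase hz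
          exact lt_of_le_of_ne (Finset.min'_le A₁ z hz1) hzne.symm
        have hgap' : ∀ a ∈ A₂, ∀ a' ∈ A₂, a < a' → (∀ z ∈ A₂, ¬ (a < z ∧ z < a')) → ∃ b ∈ B', a ≤ b ∧ b ≤ a' := by
          intro a ha a' ha' haa' hz
          have haA : a ∈ A := Finset.mem_of_mem_erase (Finset.mem_of_mem_erase ha)
          have ha'A : a' ∈ A := Finset.mem_of_mem_erase (Finset.mem_of_mem_erase ha')
          have ha1 : a₁ < a := hgt a ha
          have hz' : ∀ z ∈ A, ¬ (a < z ∧ z < a') := by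
            intro z hz1 hzz
            by_cases hz0 : z = a₀
            · rw [hz0] at hzz; exact absurd (hlt.trans (ha1.trans hzz.1)) (lt_irrefl _)
            · by_cases hz1' : z = a₁
              · rw [hz1'] at hzz; exact absurd (ha1.trans hzz.1) (lt_irrefl _)
              · exact hz z (Finset.mem_erase.mpr ⟨hz1', Finset.mem_erase.mpr ⟨hz0, hz1⟩⟩) hzz
          obtain ⟨b, hb, hbl, hbr⟩ := hgap a haA a' ha'A haa' hz'
          refine ⟨b, ?_, hbl, hbr⟩
          rw [hB', Finset.mem_filter]
          exact ⟨hb, ha1.trans_le hbl⟩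
        have h := ih (A.card - 2) (by omega) A₂ B' hA₂card hgap'
        omega

/-! ## 2. The root-gap count of the α register -/

variable (a : ℕ → ℝ) (d : ℕ → ℕ) (b : ℕ → ℝ) (f : ℕ → ℕ)

/-- **THE ROOT-GAP COUNT (all sizes, every gauge).**  For a static symmetric tridiagonal design (continuants `D_k = pathDet a d b f k`), an alternating
antiderivative `G` of the doubled link exponents (any `G 0`), and ANY finite set `B ⊂ ℝ` containing every positive zero of `D_k` and every positive zero of the
gauged Wronskian `Ω_G = X·(D′_{k+1}D_k − D_{k+1}D′_k) − G_k·D_kD_{k+1}`:  `#{positive zeros of D_{k+1}} ≤ 2·#B + 1`. [bookkeeping of this seat] -/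
theorem card_posRoots_le_of_gaugedWronskian (G : ℕ → ℤ) (hG : ∀ j, G (j + 1) = 2 * (f j : ℤ) - G j) (k : ℕ) (B : Finset ℝ)
    (hBk : ∀ y, 0 < y → (pathDet a d b f k).eval y = 0 → y ∈ B)
    (hBΩ : ∀ y, 0 < y → ((X : ℝ[X]) * (derivative (pathDet a d b f (k + 1)) * pathDet a d b f k
          - pathDet a d b f (k + 1) * derivative (pathDet a d b f k))
        - C ((G k : ℝ)) * pathDet a d b f k * pathDet a d b f (k + 1)).eval y = 0 → y ∈ B) :
    ((pathDet a d b f (k + 1)).roots.toFinset.filter fun t : ℝ => 0 < t).card ≤ 2 * B.card + 1 := by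
  classical
  set P := pathDet a d b f (k + 1) with hP
  set A := P.roots.toFinset.filter fun t : ℝ => 0 < t with hA
  refine card_le_two_mul_card_add_one_of_gaps A.card A B rfl ?_
  intro x₁ hx₁ x₂ hx₂ hlt hcons
  rw [hA, Finset.mem_filter, Multiset.mem_toFinset] at hx₁ hx₂
  have hP0 : P ≠ 0 := (Polynomial.mem_roots'.mp hx₁.1).1
  have hr₁ : P.eval x₁ = 0 := (Polynomial.mem_roots hP0).mp hx₁.1
  have hr₂ : P.eval x₂ = 0 := (Polynomial.mem_roots hP0).mp hx₂.1
  have hpos₁ : 0 < x₁ := hx₁.2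
  -- no root of `P` strictly between (consecutive elements of `A`)
  have hno : ∀ y, x₁ < y → y < x₂ → P.eval y ≠ 0 := by
    intro y hy1 hy2 hy
    refine hcons y ?_ ⟨hy1, hy2⟩
    rw [hA, Finset.mem_filter, Multiset.mem_toFinset, Polynomial.mem_roots hP0]
    exact ⟨hy, hpos₁.trans hy1⟩
  -- either `D_k` vanishes on `[x₁, x₂]`, or the gauged Wronskian does
  by_cases hk : ∃ y, x₁ ≤ y ∧ y ≤ x₂ ∧ (pathDet a d b f k).eval y = 0
  · obtain ⟨y, hy1, hy2, hy⟩ := hk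
    exact ⟨y, hBk y (hpos₁.trans_le hy1) hy, hy1, hy2⟩
  · have hk' : ∀ y, x₁ ≤ y → y ≤ x₂ → (pathDet a d b f k).eval y ≠ 0 := fun y h1 h2 hy => hk ⟨y, h1, h2, hy⟩
    obtain ⟨y, ⟨hy1, hy2⟩, hy⟩ :=
      exists_root_gaugedWronskian_of_consecutive_roots a d b f G hG k hpos₁ hlt hr₁ hr₂ hno hk'
    exact ⟨y, hBΩ y (hpos₁.trans_le hy1) hy, hy1, hy2⟩

end StaticTridiagonalRealPotential

end Summit.ValiantsHypothesis.ValiantsHypothesis.Theorems.KPlusLogSqLaw
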